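import Mathlib
import HarnessLib
import Summits.Ventures.LatticeQCDFlow.Exactness.IMHKernelTransport
import Summits.Ventures.LatticeQCDFlow.Exactness.FlowSamplerTranslationCovariance

/-!
# Flow samplers with a merely MEASURABLE Jacobian (the spectral flows) are symmetric IN LAW at every step: the weight is symmetric a.e., the hot start and the model law are absolutely continuous starts; lattice translations instantiated for every group

HONEST FRAMING: exact (Metropolis-corrected) sampling algorithms for lattice gauge theory;
figures of merit are autocorrelation/cost numbers at stated couplings and volumes; no
continuum-physics claim.

Venture `LatticeQCDFlow` (cell pub-lqcd), topic `Exactness`; FANOUT row 10 (`eng-equiv`, engine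
`latflow.equiv` / `latflow.flows_jax`: Boyda's `SU(N)` spectral coupling layers `spectral.py`, whose
booked Jacobians are measurable and NOT continuous — `SpectralDensityMeasurable`,
`SUNSpectralPlaquetteLayerShipped`; flow sampler `equiv/imh.py`).  NEW WORK of the cell; nothing is
cited as a fact; no number; no definition is introduced.  `FlowSamplerTranslationCovariance` needs a
weight invariant EVERYWHERE (continuous Jacobian); `IMHKernelTransport` says what an a.e.-invariant
weight still gives (`ae_conjKernel_indepMH_eq`, `iterate_bind_indepMH_map_eq_self_of_ae`).  This file
closes the gap between the two for flows of the form "push a symmetric prior through a symmetric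
automorphism with a measurable exact Jacobian": the weight `g · (J ∘ Ψ⁻¹)` IS symmetric almost
everywhere for the model law, the hot start and the model law ARE admissible starts, and for lattice
translations every hypothesis is discharged from GEN-15's `HasJacobian.jac_siteTranslate_ae_eq`.

## What is typed

* §1 (any measurable space; `Ψ ∘ Θ = Θ ∘ Ψ`) — **`flowWeight_ae_symm`**: `J ∘ Θ = J` `π`-a.e. and
  `g ∘ Θ = g` give `w ∘ Θ = w` `(Ψ_* π)`-a.e. for `w = g · (J ∘ Ψ⁻¹)`;
  `absolutelyContinuous_flowModel_of_hasJacobian` — `π ≪ Ψ_* π` whenever `Ψ` has an exact Jacobian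
  for `π` (so the HOT start `π` is an admissible start); **`iterate_bind_flowSampler_map_eq_self_of_ae`**
  — from any `Θ`-invariant start `μ₀ ≪ Ψ_* π` the law of the flow-sampler run is `Θ`-invariant at
  every step; `…_hotStart_…`, `…_modelStart_…`;
* §2 (lattice, compact second-countable `G`, product Haar, Wilson target, any continuous
  representation) — **`wilsonFlowSampler_iterate_law_map_configTranslate_of_measurableJacobian`**:
  `Ψ (V·v) = (Ψ V)·v` and a MEASURABLE exact Jacobian `J ≥ 0` suffice for the law of the run from any
  `T_v`-invariant start `≪ Ψ_* Haar^⊗` to be `T_v`-invariant at every step;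
  `wilsonFlowSampler_hotStart_iterate_law_map_configTranslate_of_measurableJacobian`.

NOT here: the concrete spectral layer (its `Ψ` and booked `J` are `SUNSpectralPlaquetteLayerEquiv` /
`SUNSpectralPlaquetteLayerShipped`, its translation covariance `SUNSpectralPlaquetteLayerTranslation` —
plug in); gauge / conjugation / centre twins (same §1 with `measurePreserving_gaugeTransform`,
`measurePreserving_configAut_piHaar`, `map_centerTwist_pi_haar` and the a.e. Jacobian lemmas); numbers.
-/

noncomputable section

namespace Summit.Ventures.LatticeQCDFlow.Exactness

open MeasureTheory ProbabilityTheory ProbabilityTheory.Kernel Set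
open Literature.MathematicalPhysics.QuantumFieldTheory
open Literature.MathematicalPhysics.QuantumFieldTheory.Luscher2010
open scoped ENNReal

/-! ## §1 Any measurable space -/

section Generic

variable {Ω : Type*} [MeasurableSpace Ω]

/-- **The importance weight `g · (J ∘ Ψ⁻¹)` of a symmetric flow with an a.e.-symmetric Jacobian is
symmetric almost everywhere for the model law `Ψ_* π`.** -/
theorem flowWeight_ae_symm {π : Measure Ω} (Ψ Θ : Ω ≃ᵐ Ω)
    (hcomm : ∀ x, Ψ (Θ x) = Θ (Ψ x)) {g J : Ω → ℝ} (hg : ∀ x, g (Θ x) = g x)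
    (hJ : (J ∘ Θ) =ᵐ[π] J) :
    ((fun x => g x * J (Ψ.symm x)) ∘ Θ) =ᵐ[π.map Ψ] (fun x => g x * J (Ψ.symm x)) := by
  -- `Ψ⁻¹` pushes the model law back to the prior, so `J ∘ Θ = J` transports along `Ψ⁻¹`
  have hsymm : MeasurePreserving Ψ.symm (π.map Ψ) π := by
    refine ⟨Ψ.symm.measurable, ?_⟩
    rw [Measure.map_map Ψ.symm.measurable Ψ.measurable, Ψ.symm_comp_self, Measure.map_id]
  have h1 : ((J ∘ Θ) ∘ Ψ.symm) =ᵐ[π.map Ψ] (J ∘ Ψ.symm) := hsymm.quasiMeasurePreserving.ae_eq hJ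
  filter_upwards [h1] with x hx
  simp only [Function.comp_apply] at hx ⊢
  have hsx : Ψ.symm (Θ x) = Θ (Ψ.symm x) := equiv_symm_comm (Ψ := Ψ.toEquiv) (Θ := Θ.toEquiv) hcomm x
  rw [hg, hsx, hx]

/-- **The prior is absolutely continuous with respect to the model law** of any flow with an exact
Jacobian for it: `π = Ψ_* (J · π) ≪ Ψ_* π` — so the HOT start is an admissible start below. -/
theorem absolutelyContinuous_flowModel_of_hasJacobian {π : Measure Ω} {Ψ : Ω ≃ᵐ Ω} {J : Ω → ℝ≥0∞}
    (h : HasJacobian π Ψ J) : π ≪ π.map Ψ := by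
  have h1 : (π.withDensity J).map Ψ ≪ π.map Ψ :=
    (withDensity_absolutelyContinuous π J).map Ψ.measurable
  rwa [h.map_eq] at h1

/-- **From any `Θ`-invariant start `μ₀ ≪ Ψ_* π`, the law of the flow-sampler run is `Θ`-invariant at
every step** — prior preserved by `Θ`, flow commuting with `Θ`, measurable target weight `g` with
`g ∘ Θ = g`, measurable `J` with `J ∘ Θ = J` only `π`-a.e. (iterate spelling; the law also stays
`≪ Ψ_* π`). -/
theorem iterate_bind_flowSampler_map_eq_self_of_ae {π : Measure Ω} [IsProbabilityMeasure π]
    (Ψ Θ : Ω ≃ᵐ Ω) (hπ : MeasurePreserving Θ π π) (hcomm : ∀ x, Ψ (Θ x) = Θ (Ψ x))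
    {g J : Ω → ℝ} (hgm : Measurable g) (hJm : Measurable J) (hg : ∀ x, g (Θ x) = g x)
    (hJ : (J ∘ Θ) =ᵐ[π] J) {μ₀ : Measure Ω} (hμ₀q : μ₀ ≪ π.map Ψ) (hμ₀ : μ₀.map Θ = μ₀) (t : ℕ) :
    haveI : IsProbabilityMeasure (π.map Ψ) := Measure.isProbabilityMeasure_map Ψ.measurable.aemeasurable
    ((fun m : Measure Ω => m.bind (indepMH (π.map Ψ) (fun x => g x * J (Ψ.symm x))))^[t] μ₀).map Θ =
        (fun m : Measure Ω => m.bind (indepMH (π.map Ψ) (fun x => g x * J (Ψ.symm x))))^[t] μ₀ ∧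
      (fun m : Measure Ω => m.bind (indepMH (π.map Ψ) (fun x => g x * J (Ψ.symm x))))^[t] μ₀ ≪ π.map Ψ := by
  haveI : IsProbabilityMeasure (π.map Ψ) := Measure.isProbabilityMeasure_map Ψ.measurable.aemeasurable
  exact iterate_bind_indepMH_map_eq_self_of_ae (hgm.mul (hJm.comp Ψ.symm.measurable)) Θ
    (measurePreserving_map_of_comm Ψ.measurable Θ hπ hcomm) (flowWeight_ae_symm Ψ Θ hcomm hg hJ) hμ₀q hμ₀ t

/-- **Hot start** (`μ₀ = π`, admissible by `absolutelyContinuous_flowModel_of_hasJacobian`). -/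
theorem iterate_bind_flowSampler_hotStart_map_eq_self_of_ae {π : Measure Ω} [IsProbabilityMeasure π]
    (Ψ Θ : Ω ≃ᵐ Ω) (hπ : MeasurePreserving Θ π π) (hcomm : ∀ x, Ψ (Θ x) = Θ (Ψ x))
    {g J : Ω → ℝ} (hgm : Measurable g) (hJm : Measurable J) (hg : ∀ x, g (Θ x) = g x)
    (hJ : (J ∘ Θ) =ᵐ[π] J) {K : Ω → ℝ≥0∞} (hK : HasJacobian π Ψ K) (t : ℕ) :
    haveI : IsProbabilityMeasure (π.map Ψ) := Measure.isProbabilityMeasure_map Ψ.measurable.aemeasurable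
    ((fun m : Measure Ω => m.bind (indepMH (π.map Ψ) (fun x => g x * J (Ψ.symm x))))^[t] π).map Θ =
      (fun m : Measure Ω => m.bind (indepMH (π.map Ψ) (fun x => g x * J (Ψ.symm x))))^[t] π :=
  (iterate_bind_flowSampler_map_eq_self_of_ae Ψ Θ hπ hcomm hgm hJm hg hJ
    (absolutelyContinuous_flowModel_of_hasJacobian hK) hπ.map_eq t).1

/-- **Model-law start** (`μ₀ = Ψ_* π`, the engine's "accept the first proposal"). -/
theorem iterate_bind_flowSampler_modelStart_map_eq_self_of_ae {π : Measure Ω} [IsProbabilityMeasure π]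
    (Ψ Θ : Ω ≃ᵐ Ω) (hπ : MeasurePreserving Θ π π) (hcomm : ∀ x, Ψ (Θ x) = Θ (Ψ x))
    {g J : Ω → ℝ} (hgm : Measurable g) (hJm : Measurable J) (hg : ∀ x, g (Θ x) = g x)
    (hJ : (J ∘ Θ) =ᵐ[π] J) (t : ℕ) :
    haveI : IsProbabilityMeasure (π.map Ψ) := Measure.isProbabilityMeasure_map Ψ.measurable.aemeasurable
    ((fun m : Measure Ω => m.bind (indepMH (π.map Ψ) (fun x => g x * J (Ψ.symm x))))^[t] (π.map Ψ)).map Θ =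
      (fun m : Measure Ω => m.bind (indepMH (π.map Ψ) (fun x => g x * J (Ψ.symm x))))^[t] (π.map Ψ) :=
  (iterate_bind_flowSampler_map_eq_self_of_ae Ψ Θ hπ hcomm hgm hJm hg hJ Measure.AbsolutelyContinuous.rfl
    (map_map_eq_self_of_comm Ψ.measurable Θ hπ.map_eq hcomm) t).1

end Generic

/-! ## §2 Lattice translations with a measurable Jacobian -/

section Lattice

variable {d L : ℕ} [NeZero L] {G : Type*} [MeasurableSpace G] [Group G] [TopologicalSpace G]
  [IsTopologicalGroup G] [CompactSpace G] [SecondCountableTopology G] [BorelSpace G] {N : ℕ}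

/-- **The Wilson flow sampler of a translation-equivariant flow with a merely MEASURABLE exact
Jacobian is translation invariant IN LAW at every step** from any `T_v`-invariant start
`μ₀ ≪ Ψ_* Haar^⊗` (`J ∘ T_v = J` a.e. is GEN-15's `HasJacobian.jac_siteTranslate_ae_eq`). -/
theorem wilsonFlowSampler_iterate_law_map_configTranslate_of_measurableJacobian
    (ρ : G →* Matrix (Fin N) (Fin N) ℂ) (hρ : Continuous ρ) (β : ℝ) (Ψ : GaugeConfig d L G ≃ᵐ GaugeConfig d L G)
    {J : GaugeConfig d L G → ℝ} (hJm : Measurable J) (hJ0 : ∀ U, 0 ≤ J U)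
    (hJac : HasJacobian (Measure.pi fun _ : Edge d L => haarProbability G) Ψ
      (fun U => ENNReal.ofReal (J U)))
    (v : Site d L)
    (hΨ : ∀ V : GaugeConfig d L G, Ψ (GaugeConfig.siteTranslate v V) = GaugeConfig.siteTranslate v (Ψ V))
    {μ₀ : Measure (GaugeConfig d L G)}
    (hμ₀q : μ₀ ≪ (Measure.pi fun _ : Edge d L => haarProbability G).map Ψ)
    (hμ₀ : μ₀.map (configTranslate v) = μ₀) (t : ℕ) :
    haveI : IsProbabilityMeasure ((Measure.pi fun _ : Edge d L => haarProbability G).map Ψ) :=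
      Measure.isProbabilityMeasure_map Ψ.measurable.aemeasurable
    ((fun m : Measure (GaugeConfig d L G) =>
        m.bind (indepMH ((Measure.pi fun _ : Edge d L => haarProbability G).map Ψ)
          (fun U => Real.exp (-β * wilsonAction ρ U) * J (Ψ.symm U))))^[t] μ₀).map (configTranslate v) =
      (fun m : Measure (GaugeConfig d L G) =>
        m.bind (indepMH ((Measure.pi fun _ : Edge d L => haarProbability G).map Ψ)
          (fun U => Real.exp (-β * wilsonAction ρ U) * J (Ψ.symm U))))^[t] μ₀ := by
  obtain ⟨_, -, -, hgm⟩ := wilsonBoltzmann_pinched (d := d) (L := L) ρ hρ β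
  have hcomm : ∀ V : GaugeConfig d L G, Ψ (configTranslate v V) = configTranslate v (Ψ V) := fun V => by
    rw [configTranslate_eq_siteTranslate, configTranslate_eq_siteTranslate, hΨ]
  -- `J ∘ T_v = J` almost everywhere, read off the `ofReal`-valued statement
  have hae := HasJacobian.jac_siteTranslate_ae_eq (haarProbability G) v hΨ hJac
  have hJ : (J ∘ configTranslate v) =ᵐ[Measure.pi fun _ : Edge d L => haarProbability G] J := by
    filter_upwards [hae] with V hV
    rw [Function.comp_apply, configTranslate_eq_siteTranslate]
    exact (ENNReal.ofReal_eq_ofReal_iff (hJ0 _) (hJ0 _)).1 hV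
  exact (iterate_bind_flowSampler_map_eq_self_of_ae Ψ (configTranslate v)
    (measurePreserving_configTranslate v (haarProbability G)) hcomm hgm hJm
    (fun V => by rw [configTranslate_eq_siteTranslate, ← configTranslate_eq_siteTranslate, wilsonAction_configTranslate])
    hJ hμ₀q hμ₀ t).1

/-- **Hot start**: `Haar^⊗ ≪ Ψ_* Haar^⊗` and `T_v`-invariant, so the law of the run from the hot start is
`T_v`-invariant at every step — measurable Jacobian, translation-equivariant flow, nothing else. -/
theorem wilsonFlowSampler_hotStart_iterate_law_map_configTranslate_of_measurableJacobian
    (ρ : G →* Matrix (Fin N) (Fin N) ℂ) (hρ : Continuous ρ) (β : ℝ) (Ψ : GaugeConfig d L G ≃ᵐ GaugeConfig d L G)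
    {J : GaugeConfig d L G → ℝ} (hJm : Measurable J) (hJ0 : ∀ U, 0 ≤ J U)
    (hJac : HasJacobian (Measure.pi fun _ : Edge d L => haarProbability G) Ψ
      (fun U => ENNReal.ofReal (J U)))
    (v : Site d L)
    (hΨ : ∀ V : GaugeConfig d L G, Ψ (GaugeConfig.siteTranslate v V) = GaugeConfig.siteTranslate v (Ψ V))
    (t : ℕ) :
    haveI : IsProbabilityMeasure ((Measure.pi fun _ : Edge d L => haarProbability G).map Ψ) :=
      Measure.isProbabilityMeasure_map Ψ.measurable.aemeasurable
    ((fun m : Measure (GaugeConfig d L G) =>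
        m.bind (indepMH ((Measure.pi fun _ : Edge d L => haarProbability G).map Ψ)
          (fun U => Real.exp (-β * wilsonAction ρ U) * J (Ψ.symm U))))^[t]
        (Measure.pi fun _ : Edge d L => haarProbability G)).map (configTranslate v) =
      (fun m : Measure (GaugeConfig d L G) =>
        m.bind (indepMH ((Measure.pi fun _ : Edge d L => haarProbability G).map Ψ)
          (fun U => Real.exp (-β * wilsonAction ρ U) * J (Ψ.symm U))))^[t]
        (Measure.pi fun _ : Edge d L => haarProbability G) :=
  wilsonFlowSampler_iterate_law_map_configTranslate_of_measurableJacobian ρ hρ β Ψ hJm hJ0 hJac v hΨ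
    (absolutelyContinuous_flowModel_of_hasJacobian hJac)
    (measurePreserving_configTranslate v (haarProbability G)).map_eq t

end Lattice

end Summit.Ventures.LatticeQCDFlow.Exactness

end
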